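import Literature.NumberTheory.Transcendental.NesterenkoEliminationFacts2Proofs
import Literature.NumberTheory.Transcendental.PhilipponCriterionPrincipal
import Literature.NumberTheory.Transcendental.PhilipponCriterionHomogenization
import Literature.NumberTheory.Transcendental.NesterenkoUResultantHeight
import Literature.NumberTheory.Transcendental.RoySmallValueFactors
import Literature.RingTheory.HilbertSamuel.PolynomialRing
import Mathlib.Algebra.Polynomial.Homogenize
import Mathlib.RingTheory.Polynomial.Eisenstein.Basic
import Mathlib.RingTheory.Polynomial.GaussLemma

/-!
# The Eisenstein orbits `(x₀^D + p x₁^D)` in Nesterenko's elimination language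
(crux `ApproximationProperty`, stmt-Schanuel-6117; test family for the negative lemmas of route
DiophantineDichotomy, line `orbit-interpolation-determinant`, stub `stub_sharpClosestPoint`; consumed by
`…/Negative/SharpClosestPointInterpolation.lean`)

The homogeneous primes `𝔭 = (x₀^D + p·x₁^D) ⊂ ℚ[x₀, x₁]` (`p` prime, `D ≥ 1`; the binary form is
irreducible by Eisenstein at `p` for `X^D + p`, Gauss's lemma, and dehomogenisation `x₁ ↦ 1`),
observed from `ω̄ = (1 : 0)`:
* `eis_ideal_hyps`: `𝔭` is prime, homogeneous, unmixed of rank `1` (a Galois orbit of `D` points);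
* `one_div_le_projDist_pow`: every zero `β` (`β₀^D = −p β₁^D`) has `‖ω̄ − β‖^D ≥ 1/p` — all `D`
  conjugates sit at the same projective distance `p^{−1/D}` from `ω̄`;
* `iabs_eis_le`: `|𝔭(ω̄)| ≤ e^{2D}/p` (LNM 1752 Ch. 3 Prop. 4.8 3), `‖E‖_{ω̄} = 1/|E| ≤ 1/p`);
* `ideg_eis`: `deg 𝔭 = D`; `iheight_eis_le`: `h(𝔭) ≤ log p + D` (Prop. 4.8 2), `h(E) ≤ log |E|`);
* `eis_interpolation`: the zeros impose independent conditions on the binary forms of degree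
  `D − 1` (`H_𝔭(D − 1) = D`: no non-zero form of degree `< D` in `(E)`, `dim ℚ[x₀,x₁]_{D−1} = D`).

Everything is proved; no definitions, no named facts.
-/

noncomputable section

-- `Summit.Schanuel.Schanuel.…` is the mandated summit/sub-problem namespace (single-conjunct summit):
set_option linter.dupNamespace false

namespace Summit.Schanuel.Schanuel.Theorems.ApproximationPropertyEisensteinOrbit

open Literature.NumberTheory.Transcendental.Nesterenko MvPolynomial
open Literature.NumberTheory.Transcendental (PhilipponMain.isUnmixedOfRank_span_singleton
  PhilipponMain.cons_one_ne_zero PhilipponMain.one_le_norm_cons_one Roy2013.isHomogeneous_of_dvd)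
open scoped BigOperators NNReal Polynomial

/-! ## The Eisenstein binary form `x₀^D + p x₁^D` -/

/-- `x₀^D + p·x₁^D` is a form of degree `D`. [folklore] -/
theorem eis_isHomogeneous (D : ℕ) (p : ℚ) :
    (X 0 ^ D + C p * X 1 ^ D : Rx 1).IsHomogeneous D := by
  have h0 : (X 0 ^ D : Rx 1).IsHomogeneous D := isHomogeneous_X_pow _ _
  have h1 : (C p * X 1 ^ D : Rx 1).IsHomogeneous D := by
    simpa using (isHomogeneous_C _ p).mul (isHomogeneous_X_pow (1 : Fin (1 + 1)) D)
  exact h0.add h1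

/-- The coefficient of `x₀^D`. [folklore] -/
theorem coeff_eis_zero {D : ℕ} (hD : D ≠ 0) (p : ℚ) :
    coeff (Finsupp.single 0 D) (X 0 ^ D + C p * X 1 ^ D : Rx 1) = 1 := by
  have hne : (Finsupp.single (1 : Fin (1 + 1)) D) ≠ Finsupp.single 0 D := by
    rw [Ne, Finsupp.single_eq_single_iff]
    push Not
    exact ⟨fun h => absurd h (by decide), fun h => absurd h hD⟩
  simp [coeff_X_pow, coeff_C_mul, hne]

/-- The coefficient of `x₁^D`. [folklore] -/
theorem coeff_eis_one {D : ℕ} (hD : D ≠ 0) (p : ℚ) :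
    coeff (Finsupp.single 1 D) (X 0 ^ D + C p * X 1 ^ D : Rx 1) = p := by
  have hne : (Finsupp.single (0 : Fin (1 + 1)) D) ≠ Finsupp.single 1 D := by
    rw [Ne, Finsupp.single_eq_single_iff]
    push Not
    exact ⟨fun h => absurd h (by decide), fun h => absurd h hD⟩
  simp [coeff_X_pow, coeff_C_mul, hne]

/-- `x₀^D + p x₁^D ≠ 0`. [folklore] -/
theorem eis_ne_zero {D : ℕ} (hD : D ≠ 0) (p : ℚ) : (X 0 ^ D + C p * X 1 ^ D : Rx 1) ≠ 0 := by
  intro h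
  simpa [h] using coeff_eis_zero hD p

/-- Evaluation: `(x₀^D + p x₁^D)(β) = β₀^D + p β₁^D`. [folklore] -/
theorem aeval_eis {A : Type*} [CommRing A] [Algebra ℚ A] (D : ℕ) (p : ℚ) (β : Fin (1 + 1) → A) :
    aeval β (X 0 ^ D + C p * X 1 ^ D : Rx 1) = β 0 ^ D + algebraMap ℚ A p * β 1 ^ D := by
  simp [map_add, map_mul, map_pow]

/-- `X^D + p` is irreducible over `ℚ` for a prime `p` and `D ≥ 1` (Eisenstein + Gauss). [folklore] -/
theorem irreducible_X_pow_add_prime {D : ℕ} (hD : D ≠ 0) {p : ℕ} (hp : p.Prime) :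
    Irreducible (Polynomial.X ^ D + Polynomial.C (p : ℚ) : ℚ[X]) := by
  have hmonic : (Polynomial.X ^ D + Polynomial.C (p : ℤ) : ℤ[X]).Monic :=
    Polynomial.monic_X_pow_add_C _ hD
  have hdeg : (Polynomial.X ^ D + Polynomial.C (p : ℤ) : ℤ[X]).natDegree = D :=
    Polynomial.natDegree_X_pow_add_C
  have hpZ : Prime (p : ℤ) := Nat.prime_iff_prime_int.mp hp
  have hPprime : (Ideal.span {(p : ℤ)}).IsPrime :=
    (Ideal.span_singleton_prime hpZ.ne_zero).mpr hpZ
  have heis : (Polynomial.X ^ D + Polynomial.C (p : ℤ) : ℤ[X]).IsEisensteinAt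
      (Ideal.span {(p : ℤ)}) := by
    refine ⟨?_, ?_, ?_⟩
    · rw [hmonic.leadingCoeff, Ideal.mem_span_singleton]
      intro h
      exact hpZ.not_unit (isUnit_of_dvd_one h)
    · intro n hn
      rw [hdeg] at hn
      rw [Polynomial.coeff_add, Polynomial.coeff_X_pow, if_neg hn.ne, zero_add,
        Polynomial.coeff_C, Ideal.mem_span_singleton]
      split_ifs
      · exact dvd_rfl
      · exact dvd_zero _
    · rw [Polynomial.coeff_add, Polynomial.coeff_X_pow, if_neg (Ne.symm hD), zero_add,
        Polynomial.coeff_C_zero, Ideal.span_singleton_pow, Ideal.mem_span_singleton]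
      intro h
      have h1 : (p : ℤ) * p ∣ (p : ℤ) * 1 := by simpa [pow_two] using h
      have h2 : (p : ℤ) ∣ 1 := (mul_dvd_mul_iff_left hpZ.ne_zero).mp h1
      exact hpZ.not_unit (isUnit_of_dvd_one h2)
  have hirrZ : Irreducible (Polynomial.X ^ D + Polynomial.C (p : ℤ) : ℤ[X]) :=
    heis.irreducible hPprime hmonic.isPrimitive (by rw [hdeg]; exact Nat.pos_of_ne_zero hD)
  have := (Polynomial.IsPrimitive.Int.irreducible_iff_irreducible_map_cast hmonic.isPrimitive).mp
    hirrZ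
  simpa [Polynomial.map_add, Polynomial.map_pow] using this

/-- The dehomogenisation `x₀ ↦ X`, `x₁ ↦ 1` of the Eisenstein form is `X^D + p`. [folklore] -/
theorem aeval_X_one_eis (D : ℕ) (p : ℚ) :
    aeval (![Polynomial.X, 1] : Fin (1 + 1) → ℚ[X]) (X 0 ^ D + C p * X 1 ^ D : Rx 1) =
      Polynomial.X ^ D + Polynomial.C p := by
  rw [aeval_eis]
  simp [Polynomial.C_eq_algebraMap]

/-- A factor of the Eisenstein form whose dehomogenisation is a unit is a unit. [folklore] -/
theorem isUnit_of_dvd_eis {D : ℕ} (hD : D ≠ 0) (p : ℚ) {A : Rx 1}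
    (hA : A ∣ (X 0 ^ D + C p * X 1 ^ D : Rx 1))
    (hu : IsUnit (aeval (![Polynomial.X, 1] : Fin (1 + 1) → ℚ[X]) A)) :
    IsUnit A := by
  have hE0 := eis_ne_zero hD p
  have hAhom : A.IsHomogeneous A.totalDegree :=
    Roy2013.isHomogeneous_of_dvd (eis_isHomogeneous D p) hE0 hA
  obtain ⟨c, hc, hcA⟩ := Polynomial.isUnit_iff.mp hu
  -- `A = c · x₁^{deg A}`
  have hAeq : A = C c * X 1 ^ A.totalDegree := by
    have h := Polynomial.homogenize_eq_of_isHomogeneous (p := Polynomial.C c) hAhom hcA.symm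
    rw [Polynomial.homogenize_C] at h
    exact h.symm
  rcases Nat.eq_zero_or_pos A.totalDegree with h0 | hpos
  · rw [hAeq, h0, pow_zero, mul_one]
    exact hc.map C
  · -- `x₁ ∣ A ∣ E`, but `E(1, 0) = 1`
    exfalso
    have hX1 : (X 1 : Rx 1) ∣ (X 0 ^ D + C p * X 1 ^ D : Rx 1) := by
      refine dvd_trans ?_ hA
      rw [hAeq]
      obtain ⟨a, ha⟩ : ∃ a, A.totalDegree = a + 1 := ⟨A.totalDegree - 1, by omega⟩
      rw [ha, pow_succ, ← mul_assoc]
      exact Dvd.intro_left _ rfl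
    obtain ⟨G, hG⟩ := hX1
    have h1 := congrArg (aeval (Fin.cons 1 0 : Fin (1 + 1) → ℚ)) hG
    rw [aeval_eis, map_mul, aeval_X] at h1
    simp [zero_pow hD] at h1

/-- **The Eisenstein form is irreducible** in `ℚ[x₀, x₁]`. [folklore] -/
theorem eis_irreducible {D : ℕ} (hD : D ≠ 0) {p : ℕ} (hp : p.Prime) :
    Irreducible (X 0 ^ D + C (p : ℚ) * X 1 ^ D : Rx 1) := by
  have hf := irreducible_X_pow_add_prime hD hp
  refine irreducible_iff.mpr ⟨fun hu => hf.not_isUnit ?_, fun A B hAB => ?_⟩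
  · have := hu.map (aeval (![Polynomial.X, 1] : Fin (1 + 1) → ℚ[X]) : Rx 1 →ₐ[ℚ] ℚ[X])
    rwa [aeval_X_one_eis] at this
  · have hfac : Polynomial.X ^ D + Polynomial.C (p : ℚ) =
        aeval (![Polynomial.X, 1] : Fin (1 + 1) → ℚ[X]) A *
          aeval (![Polynomial.X, 1] : Fin (1 + 1) → ℚ[X]) B := by
      rw [← map_mul, ← hAB, aeval_X_one_eis]
    rcases hf.isUnit_or_isUnit hfac with hA | hB
    · exact Or.inl (isUnit_of_dvd_eis hD _ ⟨B, hAB⟩ hA)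
    · exact Or.inr (isUnit_of_dvd_eis hD _ ⟨A, by rw [hAB, mul_comm]⟩ hB)


/-! ## The Eisenstein orbit in Nesterenko's language -/

/-- The ideal `𝔭 = (x₀^D + p x₁^D)` is a homogeneous prime, unmixed of rank `1`. [folklore] -/
theorem eis_ideal_hyps {D : ℕ} (hD : D ≠ 0) {p : ℕ} (hp : p.Prime) :
    (Ideal.span {(X 0 ^ D + C (p : ℚ) * X 1 ^ D : Rx 1)}).IsPrime ∧
    (letI := MvPolynomial.gradedAlgebra (σ := Fin (1 + 1)) (R := ℚ)
     (Ideal.span {(X 0 ^ D + C (p : ℚ) * X 1 ^ D : Rx 1)}).IsHomogeneous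
      (homogeneousSubmodule (Fin (1 + 1)) ℚ)) ∧
    IsUnmixedOfRank (Ideal.span {(X 0 ^ D + C (p : ℚ) * X 1 ^ D : Rx 1)}) 1 := by
  letI := MvPolynomial.gradedAlgebra (σ := Fin (1 + 1)) (R := ℚ)
  have hE0 := eis_ne_zero hD (p : ℚ)
  have hirr := eis_irreducible hD hp
  refine ⟨(Ideal.span_singleton_prime hE0).mpr hirr.prime, ?_,
    PhilipponMain.isUnmixedOfRank_span_singleton hE0 hirr.not_isUnit⟩
  refine Ideal.homogeneous_span _ _ fun x hx => ?_
  rw [Set.mem_singleton_iff] at hx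
  subst hx
  exact ⟨D, eis_isHomogeneous D _⟩

/-- The sup norm of `ω̄ = (1 : 0)` is `1`. [folklore] -/
theorem norm_cons_one_zero : ‖(Fin.cons 1 0 : Fin (1 + 1) → ℂ)‖ = 1 := by
  refine le_antisymm ?_ (PhilipponMain.one_le_norm_cons_one 0)
  exact (pi_norm_le_iff_of_nonneg zero_le_one).mpr fun j => Fin.cases (by simp) (fun i => by simp) j

/-- **Zeros of the Eisenstein orbit, seen from `(1 : 0)`**: every projective zero `β` of
`(x₀^D + p x₁^D)` has `β₀ ≠ 0` and projective distance `‖(1:0) − β‖` with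
`‖(1:0) − β‖^D ≥ 1/p` (in fact `= 1/p`). [folklore] -/
theorem one_div_le_projDist_pow {D : ℕ} (hD : D ≠ 0) {p : ℕ} (hp : p.Prime)
    {β : Fin (1 + 1) → ℂ}
    (hβ : β ∈ projZeros (Ideal.span {(X 0 ^ D + C (p : ℚ) * X 1 ^ D : Rx 1)})) :
    1 / (p : ℝ) ≤ projDist (Fin.cons 1 0 : Fin (1 + 1) → ℂ) β ^ D := by
  obtain ⟨hβ0, hzero⟩ := hβ
  have hp0 : (0 : ℝ) < p := by exact_mod_cast hp.pos
  have hp1 : (1 : ℝ) ≤ p := by exact_mod_cast hp.one_lt.le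
  have hval : β 0 ^ D + (p : ℂ) * β 1 ^ D = 0 := by
    have := hzero _ (Ideal.subset_span rfl)
    rwa [aeval_eis, map_natCast] at this
  -- `|β₀|^D = p |β₁|^D`
  have hnorm : ‖β 0‖ ^ D = p * ‖β 1‖ ^ D := by
    have h1 : β 0 ^ D = -((p : ℂ) * β 1 ^ D) := eq_neg_of_add_eq_zero_left hval
    have h2 := congrArg (fun z : ℂ => ‖z‖) h1
    simp only [norm_neg, norm_mul, norm_pow, Complex.norm_natCast] at h2
    exact h2
  have hβ1 : β 1 ≠ 0 := by
    intro h1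
    apply hβ0
    have h0 : β 0 = 0 :=
      norm_eq_zero.mp ((pow_eq_zero_iff hD).mp (by rw [hnorm, h1, norm_zero, zero_pow hD, mul_zero]))
    funext j
    refine Fin.cases ?_ (fun i => ?_) j
    · simpa using h0
    · have : i = 0 := Subsingleton.elim _ _
      subst this
      simpa using h1
  have hn1 : 0 < ‖β 1‖ := norm_pos_iff.mpr hβ1
  have hle10 : ‖β 1‖ ≤ ‖β 0‖ := by
    have : ‖β 1‖ ^ D ≤ ‖β 0‖ ^ D := by
      rw [hnorm]
      exact le_mul_of_one_le_left (by positivity) hp1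
    exact le_of_pow_le_pow_left₀ hD (norm_nonneg _) this
  have hn0 : 0 < ‖β 0‖ := hn1.trans_le hle10
  -- `‖β‖ = |β₀|`
  have hβnorm : ‖β‖ ≤ ‖β 0‖ := by
    refine (pi_norm_le_iff_of_nonneg (norm_nonneg _)).mpr fun j => ?_
    refine Fin.cases ?_ (fun i => ?_) j
    · exact le_rfl
    · have : i = 0 := Subsingleton.elim _ _
      subst this
      exact hle10
  -- numerator of the projective distance `≥ |β₁|`
  set φ : Fin (1 + 1) → ℂ := Fin.cons 1 0 with hφ
  have hnum : ‖β 1‖ ≤ ((Finset.univ.sup fun q : SkewIdx 1 =>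
      ‖φ q.1.1 * β q.1.2 - φ q.1.2 * β q.1.1‖₊ : ℝ≥0) : ℝ) := by
    let q₀ : SkewIdx 1 := ⟨(0, 1), by decide⟩
    have h := Finset.le_sup (f := fun q : SkewIdx 1 =>
      ‖φ q.1.1 * β q.1.2 - φ q.1.2 * β q.1.1‖₊) (Finset.mem_univ q₀)
    have hq : ‖φ q₀.1.1 * β q₀.1.2 - φ q₀.1.2 * β q₀.1.1‖₊ = ‖β 1‖₊ := by
      simp [q₀, hφ]
    rw [hq] at h
    exact_mod_cast h
  have hφ1 : ‖φ‖ = 1 := norm_cons_one_zero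
  have hproj : ‖β 1‖ / ‖β 0‖ ≤ projDist φ β := by
    rw [projDist, hφ1, one_mul]
    calc ‖β 1‖ / ‖β 0‖ ≤ ‖β 1‖ / ‖β‖ := by
          exact div_le_div_of_nonneg_left (norm_nonneg _) (hn0.trans_le (norm_le_pi_norm β 0))
            hβnorm
      _ ≤ _ := by
          exact div_le_div_of_nonneg_right hnum (norm_nonneg _)
  have hq0 : 0 ≤ ‖β 1‖ / ‖β 0‖ := by positivity
  calc 1 / (p : ℝ) = (‖β 1‖ / ‖β 0‖) ^ D := by
        rw [div_pow, hnorm]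
        field_simp
    _ ≤ projDist φ β ^ D := pow_le_pow_left₀ hq0 hproj D

/-- **Value of the Eisenstein orbit at `(1 : 0)`**: `|𝔭(1 : 0)| ≤ e^{2D}/p` (LNM 1752 Ch. 3
Prop. 4.8 3) for the principal ideal, `‖E‖_{(1:0)} = 1/|E| ≤ 1/p`). [folklore] -/
theorem iabs_eis_le {D : ℕ} (hD : D ≠ 0) {p : ℕ} (hp : p.Prime) :
    iabs (Ideal.span {(X 0 ^ D + C (p : ℚ) * X 1 ^ D : Rx 1)}) 1 (Fin.cons 1 0) ≤
      Real.exp (2 * D) / p := by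
  have hE0 := eis_ne_zero hD (p : ℚ)
  have hEhom := eis_isHomogeneous D (p : ℚ)
  have hp0 : (0 : ℝ) < p := by exact_mod_cast hp.pos
  have hω0 : (Fin.cons 1 0 : Fin (1 + 1) → ℂ) ≠ 0 := PhilipponMain.cons_one_ne_zero 0
  have h := iabs_span_singleton_le (m := 1) le_rfl hE0 hEhom (Nat.pos_of_ne_zero hD) hω0
  -- `‖E‖_{(1:0)} ≤ 1/p`
  have hval : aeval (Fin.cons 1 0 : Fin (1 + 1) → ℂ) (X 0 ^ D + C (p : ℚ) * X 1 ^ D : Rx 1) = 1 := by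
    rw [aeval_eis]
    simp [zero_pow hD]
  have hmax : (p : ℝ) ≤ maxNorm (X 0 ^ D + C (p : ℚ) * X 1 ^ D : Rx 1) := by
    have := norm_coeff_le_maxNorm (X 0 ^ D + C (p : ℚ) * X 1 ^ D : Rx 1) (Finsupp.single 1 D)
    rw [coeff_eis_one hD] at this
    have hn : ‖((p : ℕ) : ℚ)‖ = (p : ℝ) := by
      rw [← Rat.norm_cast_real]
      simp
    rwa [hn] at this
  have hnormAt : normAt (Fin.cons 1 0 : Fin (1 + 1) → ℂ) (X 0 ^ D + C (p : ℚ) * X 1 ^ D : Rx 1) ≤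
      1 / p := by
    rw [normAt, hval, norm_one, norm_cons_one_zero, one_pow, mul_one]
    exact one_div_le_one_div_of_le hp0 hmax
  calc iabs (Ideal.span {(X 0 ^ D + C (p : ℚ) * X 1 ^ D : Rx 1)}) 1 (Fin.cons 1 0)
      ≤ normAt (Fin.cons 1 0 : Fin (1 + 1) → ℂ) (X 0 ^ D + C (p : ℚ) * X 1 ^ D : Rx 1) *
          Real.exp (2 * (1 : ℕ) ^ 2 * D) := by exact_mod_cast h
    _ ≤ 1 / p * Real.exp (2 * D) := by
        gcongr
        · norm_num
    _ = Real.exp (2 * D) / p := by ring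

/-- Degree of the Eisenstein orbit: `deg 𝔭 = D`. [folklore] -/
theorem ideg_eis {D : ℕ} (hD : D ≠ 0) (p : ℕ) :
    ideg (Ideal.span {(X 0 ^ D + C (p : ℚ) * X 1 ^ D : Rx 1)}) 1 = D :=
  ideg_span_singleton (m := 1) le_rfl (eis_ne_zero hD _) (eis_isHomogeneous D _)
    (Nat.pos_of_ne_zero hD)

/-! ## With the interpolation datum: height and Hilbert function of the Eisenstein orbit -/

/-- `‖(p : ℚ)‖ = p` for a natural number `p`. [folklore] -/
theorem norm_natCast_rat (p : ℕ) : ‖((p : ℕ) : ℚ)‖ = (p : ℝ) := by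
  rw [← Rat.norm_cast_real]
  simp

/-- `|x₀^D + p x₁^D| ≤ p` (the coefficients are `1` and `p`). [folklore] -/
theorem maxNorm_eis_le {D : ℕ} (hD : D ≠ 0) {p : ℕ} (hp : p.Prime) :
    maxNorm (X 0 ^ D + C (p : ℚ) * X 1 ^ D : Rx 1) ≤ p := by
  have hp1 : (1 : ℝ) ≤ p := by exact_mod_cast hp.one_lt.le
  -- `|P| ≤ p` as soon as every coefficient has modulus `≤ p`
  suffices h : ∀ γ, ‖(X 0 ^ D + C (p : ℚ) * X 1 ^ D : Rx 1).coeff γ‖ ≤ p by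
    have key : ((X 0 ^ D + C (p : ℚ) * X 1 ^ D : Rx 1).support.sup fun γ =>
        ‖(X 0 ^ D + C (p : ℚ) * X 1 ^ D : Rx 1).coeff γ‖₊ : ℝ≥0) ≤ Real.toNNReal p := by
      refine Finset.sup_le fun γ _ => ?_
      rw [← NNReal.coe_le_coe, coe_nnnorm, Real.coe_toNNReal _ (by linarith)]
      exact h γ
    have key' := NNReal.coe_le_coe.mpr key
    rwa [Real.coe_toNNReal _ (by linarith)] at key'
  intro γ
  simp only [coeff_add, coeff_C_mul, coeff_X_pow]
  split_ifs with h0 h1 h1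
  · exfalso
    rw [← h1, Finsupp.single_eq_single_iff] at h0
    rcases h0 with ⟨h, -⟩ | ⟨h, -⟩
    · exact absurd h (by decide)
    · exact hD h
  · simp
    exact hp.one_lt.le
  · rw [zero_add, mul_one, norm_natCast_rat]
  · simp

/-- Height of the Eisenstein orbit: `h(𝔭) ≤ log p + D` (LNM 1752 Ch. 3 Prop. 4.8 2),
`h(E) ≤ log |E|` for integer coefficients). [folklore] -/
theorem iheight_eis_le {D : ℕ} (hD : D ≠ 0) {p : ℕ} (hp : p.Prime) :
    iheight (Ideal.span {(X 0 ^ D + C (p : ℚ) * X 1 ^ D : Rx 1)}) 1 ≤ Real.log p + D := by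
  have hE0 := eis_ne_zero hD (p : ℚ)
  have hEhom := eis_isHomogeneous D (p : ℚ)
  have hp0 : (0 : ℝ) < p := by exact_mod_cast hp.pos
  have h := iheight_span_singleton_le (m := 1) hE0 hEhom (Nat.pos_of_ne_zero hD)
  set Z : MvPolynomial (Fin (1 + 1)) ℤ := X 0 ^ D + C (p : ℤ) * X 1 ^ D with hZ
  have hZE : MvPolynomial.map (Int.castRingHom ℚ) Z = (X 0 ^ D + C (p : ℚ) * X 1 ^ D : Rx 1) := by
    simp [hZ, map_add, map_mul, map_pow, map_X]
  have hZ0 : Z ≠ 0 := fun h0 => hE0 (by rw [← hZE, h0, map_zero])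
  have hht : height (X 0 ^ D + C (p : ℚ) * X 1 ^ D : Rx 1) ≤
      Real.log (maxNorm (X 0 ^ D + C (p : ℚ) * X 1 ^ D : Rx 1)) := by
    have := height_map_le_log_maxNorm Z hZ0
    rwa [hZE] at this
  have hpmax : (p : ℝ) ≤ maxNorm (X 0 ^ D + C (p : ℚ) * X 1 ^ D : Rx 1) := by
    have := norm_coeff_le_maxNorm (X 0 ^ D + C (p : ℚ) * X 1 ^ D : Rx 1) (Finsupp.single 1 D)
    rwa [coeff_eis_one hD, norm_natCast_rat] at this
  have hlog : Real.log (maxNorm (X 0 ^ D + C (p : ℚ) * X 1 ^ D : Rx 1)) ≤ Real.log p :=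
    Real.log_le_log (hp0.trans_le hpmax) (maxNorm_eis_le hD hp)
  calc iheight (Ideal.span {(X 0 ^ D + C (p : ℚ) * X 1 ^ D : Rx 1)}) 1
      ≤ height (X 0 ^ D + C (p : ℚ) * X 1 ^ D : Rx 1) + ((1 : ℕ) : ℝ) ^ 2 * D := h
    _ ≤ Real.log p + D := by
        rw [Nat.cast_one, one_pow, one_mul]
        linarith

/-- **The interpolation datum of the Eisenstein orbit**: its `D` zeros impose independent
conditions on the binary forms of degree `D − 1` (`H_𝔭(D−1) = D = deg 𝔭`: no non-zero form of
degree `< D` lies in `(E)`, and `dim ℚ[x₀,x₁]_{D−1} = D`). [folklore] -/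
theorem eis_interpolation {D : ℕ} (hD : D ≠ 0) (p : ℕ) :
    Module.finrank ℚ ↥(homogeneousSubmodule (Fin (1 + 1)) ℚ (D - 1)) =
      Module.finrank ℚ ↥(homogeneousSubmodule (Fin (1 + 1)) ℚ (D - 1) ⊓
        (Ideal.span {(X 0 ^ D + C (p : ℚ) * X 1 ^ D : Rx 1)}).restrictScalars ℚ) +
        ideg (Ideal.span {(X 0 ^ D + C (p : ℚ) * X 1 ^ D : Rx 1)}) 1 := by
  have hE0 := eis_ne_zero hD (p : ℚ)
  have hEhom := eis_isHomogeneous D (p : ℚ)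
  have hbot : homogeneousSubmodule (Fin (1 + 1)) ℚ (D - 1) ⊓
      (Ideal.span {(X 0 ^ D + C (p : ℚ) * X 1 ^ D : Rx 1)}).restrictScalars ℚ = ⊥ := by
    rw [eq_bot_iff]
    intro x hx
    obtain ⟨hxdeg, hxI⟩ := Submodule.mem_inf.mp hx
    rw [Submodule.restrictScalars_mem] at hxI
    rw [Submodule.mem_bot]
    obtain ⟨g, rfl⟩ := Ideal.mem_span_singleton'.mp hxI
    by_contra hx0
    have hg0 : g ≠ 0 := fun h => hx0 (by rw [h, zero_mul])
    have hdeg := totalDegree_mul_of_isDomain hg0 hE0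
    have hxhom : (g * (X 0 ^ D + C (p : ℚ) * X 1 ^ D : Rx 1)).IsHomogeneous (D - 1) :=
      (mem_homogeneousSubmodule _ _).mp hxdeg
    have h1 := hxhom.totalDegree hx0
    rw [hEhom.totalDegree hE0] at hdeg
    omega
  rw [hbot, finrank_bot, ideg_eis hD p,
    Literature.RingTheory.HilbertSamuel.finrank_homogeneousSubmodule_fin]
  obtain ⟨n, rfl⟩ : ∃ n, D = n + 1 := ⟨D - 1, by omega⟩
  rw [Nat.add_sub_cancel, show n + (1 + 1) - 1 = n + 1 by omega, Nat.choose_succ_self_right,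
    zero_add]

end Summit.Schanuel.Schanuel.Theorems.ApproximationPropertyEisensteinOrbit

end
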